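import Summits.BirchSwinnertonDyer.BirchSwinnertonDyer.Theses.BiquadraticEisensteinDescent
import Summits.BirchSwinnertonDyer.BirchSwinnertonDyer.Theorems.BiquadraticEisensteinDescentHeegnerFieldSupplyAdmissibilityCMInertBad
import HarnessLib

/-!
# Route BiquadraticEisensteinDescent — KS REDUCED TO QUADRATIC FIELDS: `HeegnerFieldSupplyCMInertBadAdm`
# (item stmt-BirchSwinnertonDyer-20198) is EQUIVALENT to its «two quadratic class numbers» form

The crux KS asks, for every CM curve `W/ℚ` of analytic rank `1` and prime `p ≥ 5` of inert-bad type, for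
ONE imaginary quadratic `K′` with `|d_K′| > 4`, the Heegner hypothesis for `N_W`, `L(W^(d_K′),1) ≠ 0`,
and the ADMISSIBILITY conjunct «every quartic `M ∋ √d_CM, √d_K′` has `p ∤ h(M)`» (`= p ∤ h(K_CM·K′)`).
By the companions `…AdmissibilityDescends.lean` (p536456) and `…AdmissibilityCMInertBad.lean` (p540613),
in the corner that conjunct is EQUIVALENT to `p ∤ h(K′) ∧ (∀ quadratic F ∋ √(d_CM·d_K′), p ∤ h(F))`
(`F` = the real quadratic `ℚ(√(d_CM d_K′))`; `h(K_CM) = 1` is a tree theorem). Hence: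

* `heegnerFieldSupplyCMInertBadAdm_of_quadraticForm` — KS follows from the QUADRATIC-FORM supply
  «∃ K′: imaginary quadratic, `4 < |d_K′|`, Heegner(`N_W`), `L(W^(d_K′),1) ≠ 0`, `p ∤ h(K′)`, and
  `p ∤ h(F)` for every quadratic `F ∋ √(d_CM·d_K′)`»;
* `quadraticForm_of_heegnerFieldSupplyCMInertBadAdm` — and conversely;
* `heegnerFieldSupplyCMInertBadAdm_iff_quadraticForm` — the equivalence.

So the open content of KS is exactly the SIMULTANEOUS supply of: Heegner splitting + twist
non-vanishing + `p ∤ h(K′)` (imaginary) + `p ∤ h(ℚ(√(d_CM d_K′)))` (real) — two couplings with no print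
at `p ≥ 5` (cell dossier HEART-KS v1.2 §5: Kohnen–Ono/Wiles/Beckwith–Raum–Richter give `p ∤ h(K′)` with
splitting, BFH/Waldspurger the twist, Byeon only `p = 3` for the imaginary/real pair). Nothing here
proves KS; this file only fixes its shape in the kernel. Helper toward KS (`--supports`
stmt-BirchSwinnertonDyer-20198). Prover seat bsd-wall-bed-p2 (g6), 2026-08-27.
-/

set_option autoImplicit false

-- D-0017 layout: summit = sub-problem, so `Summit.BirchSwinnertonDyer.BirchSwinnertonDyer.…` is the mandated namespace.
set_option linter.dupNamespace false

open Module NumberField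
open Literature.NumberTheory.EllipticCurves
open Summit.BirchSwinnertonDyer.BirchSwinnertonDyer.Theses.BiquadraticEisensteinDescent

namespace Summit.BirchSwinnertonDyer.BirchSwinnertonDyer.Theorems.BiquadraticEisensteinDescentHeegnerFieldSupplyQuadraticForm

/-- **KS from the quadratic-form supply.** If for every CM curve `W` of analytic rank `1` and every
`p ≥ 5` of inert-bad type there is an imaginary quadratic `K′` with `4 < |d_K′|`, the Heegner hypothesis
for `N_W`, `L(W^(d_K′),1) ≠ 0`, `p ∤ h(K′)`, and `p ∤ h(F)` for every quadratic field `F` containing a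
square root of `d_CM·d_K′`, then `HeegnerFieldSupplyCMInertBadAdm` holds (the admissibility conjunct is
manufactured by `…AdmissibilityCMInertBad.admissible_of_not_dvd_classNumber`). [folklore] -/
theorem heegnerFieldSupplyCMInertBadAdm_of_quadraticForm
    (h : ∀ (W : WeierstrassCurve ℚ) [W.IsElliptic] [W.IsGloballyMinimal] (p : ℕ) [Fact p.Prime]
      [NeZero (W.conductorNorm ℤ)], W.HasCM → W.analyticRank = 1 → 5 ≤ p →
      Rank1Residual.CMInert W p → ¬ Rank1Residual.Good W p →
      ∃ (K : Type) (_ : Field K) (_ : NumberField K), IsImaginaryQuadratic K ∧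
        4 < (NumberField.discr K).natAbs ∧ SatisfiesHeegnerHypothesis (W.conductorNorm ℤ) K ∧
        (W.quadraticTwist (NumberField.discr K : ℚ)).entireLFunction 1 ≠ 0 ∧
        ¬ p ∣ NumberField.classNumber K ∧
        (∀ (F : Type) [Field F] [NumberField F], finrank ℚ F = 2 →
          (∃ z : F, z ^ 2 = ((Rank1Residual.cmFieldDiscrOfJ W.j * NumberField.discr K : ℤ) : F)) →
          ¬ p ∣ NumberField.classNumber F)) :
    HeegnerFieldSupplyCMInertBadAdm := by
  intro W _ _ p _ _ hCM hr hp5 hin hbad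
  obtain ⟨K, iF, iN, hK, hd4, hHN, hLt, hK', hF⟩ := h W p hCM hr hp5 hin hbad
  have hp2 : p ≠ 2 := by omega
  exact ⟨K, iF, iN, hK, hd4, hHN, hLt,
    BiquadraticEisensteinDescentHeegnerFieldSupplyAdmissibilityCMInertBad.admissible_of_not_dvd_classNumber
      W hp2 hin hbad K hK hHN hK' hF⟩

/-- **Conversely, KS implies the quadratic-form supply** (`…AdmissibilityDescends.not_dvd_classNumber_heegnerField_of_admissible`
and `…AdmissibilityCMInertBad.not_dvd_classNumber_real_of_admissible`). [folklore] -/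
theorem quadraticForm_of_heegnerFieldSupplyCMInertBadAdm (h : HeegnerFieldSupplyCMInertBadAdm) :
    ∀ (W : WeierstrassCurve ℚ) [W.IsElliptic] [W.IsGloballyMinimal] (p : ℕ) [Fact p.Prime]
      [NeZero (W.conductorNorm ℤ)], W.HasCM → W.analyticRank = 1 → 5 ≤ p →
      Rank1Residual.CMInert W p → ¬ Rank1Residual.Good W p →
      ∃ (K : Type) (_ : Field K) (_ : NumberField K), IsImaginaryQuadratic K ∧
        4 < (NumberField.discr K).natAbs ∧ SatisfiesHeegnerHypothesis (W.conductorNorm ℤ) K ∧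
        (W.quadraticTwist (NumberField.discr K : ℚ)).entireLFunction 1 ≠ 0 ∧
        ¬ p ∣ NumberField.classNumber K ∧
        (∀ (F : Type) [Field F] [NumberField F], finrank ℚ F = 2 →
          (∃ z : F, z ^ 2 = ((Rank1Residual.cmFieldDiscrOfJ W.j * NumberField.discr K : ℤ) : F)) →
          ¬ p ∣ NumberField.classNumber F) := by
  intro W _ _ p _ _ hCM hr hp5 hin hbad
  obtain ⟨K, iF, iN, hK, hd4, hHN, hLt, hAdm⟩ := h W p hCM hr hp5 hin hbad
  have hp2 : p ≠ 2 := by omega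
  refine ⟨K, iF, iN, hK, hd4, hHN, hLt, ?_, ?_⟩
  · exact BiquadraticEisensteinDescentHeegnerFieldSupplyAdmissibilityDescends.not_dvd_classNumber_heegnerField_of_admissible
      W hp2 hin hbad K hK hHN hAdm
  · intro F _ _ h2 hz
    obtain ⟨z, hz⟩ := hz
    exact BiquadraticEisensteinDescentHeegnerFieldSupplyAdmissibilityCMInertBad.not_dvd_classNumber_real_of_admissible
      W hp2 hin hbad K hK hHN hAdm F h2 hz

/-- **KS ⟺ its quadratic-class-number form.** For the crux `HeegnerFieldSupplyCMInertBadAdm`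
(stmt-BirchSwinnertonDyer-20198): the biquadratic admissibility conjunct may be replaced, salva
veritate, by «`p ∤ h(K′)` and `p ∤ h(F)` for every quadratic `F ∋ √(d_CM·d_K′)`» — the kernel form of the
cell dossier's Δ-h⁻ (Kuroda/Herglotz with `h(K_CM) = 1`), both directions proved. [folklore] -/
theorem heegnerFieldSupplyCMInertBadAdm_iff_quadraticForm :
    HeegnerFieldSupplyCMInertBadAdm ↔
    ∀ (W : WeierstrassCurve ℚ) [W.IsElliptic] [W.IsGloballyMinimal] (p : ℕ) [Fact p.Prime]
      [NeZero (W.conductorNorm ℤ)], W.HasCM → W.analyticRank = 1 → 5 ≤ p →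
      Rank1Residual.CMInert W p → ¬ Rank1Residual.Good W p →
      ∃ (K : Type) (_ : Field K) (_ : NumberField K), IsImaginaryQuadratic K ∧
        4 < (NumberField.discr K).natAbs ∧ SatisfiesHeegnerHypothesis (W.conductorNorm ℤ) K ∧
        (W.quadraticTwist (NumberField.discr K : ℚ)).entireLFunction 1 ≠ 0 ∧
        ¬ p ∣ NumberField.classNumber K ∧
        (∀ (F : Type) [Field F] [NumberField F], finrank ℚ F = 2 →
          (∃ z : F, z ^ 2 = ((Rank1Residual.cmFieldDiscrOfJ W.j * NumberField.discr K : ℤ) : F)) →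
          ¬ p ∣ NumberField.classNumber F) :=
  ⟨quadraticForm_of_heegnerFieldSupplyCMInertBadAdm, heegnerFieldSupplyCMInertBadAdm_of_quadraticForm⟩

end Summit.BirchSwinnertonDyer.BirchSwinnertonDyer.Theorems.BiquadraticEisensteinDescentHeegnerFieldSupplyQuadraticForm
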